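import Literature.AnabelianGeometry.AbsoluteAnabelian.AbsTopII.EllipticCuspidalizationComparisonTF
import Literature.AnabelianGeometry.AbsoluteAnabelian.AbsTopII.SemiEllipticTransport
import HarnessLib

/-!
# [AbsTopII] Cor 3.3 (ii), PRINT-FAITHFUL form: the group-theoretic description is invariant under
# isomorphisms `φ : Π_{C₁} ⥲ Π_{C₂}` with `φ(Δ_{C₁}) = Δ_{C₂}` — kernel proofs (successor twins of
# abc-iut-L4-t6's `SemiEllipticTransport.lean`)

S. Mochizuki, *Topics in Absolute Anabelian Geometry II: Decomposition Groups and Endomorphisms*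
[AbsTopII] (bib `MochizukiAbsTopII2013`; kurims manuscript `paper:url-585b8d0ad0d9`, cell render
`HOME/lit/renders/AbsTopII-kurims-url-585b8d0ad0d9/p0068.txt` l.7–11), §3, Corollary 3.3 (ii) p. 68:
"… may be characterized 'group-theoretically' as the collection of open subgroups `J ⊆ Π_C` of index
`2` such that `J ∩ Δ_C` [where `Δ_C := Ker(Π_C ↠ G')`] is torsion-free [i.e., the covering determined
by `J` is a scheme — cf. [AbsTopI], Lemma 4.1, (iv)]."  Cor 3.4 proof p. 70: "The construction of `φ_U` follows immediately from Corollary 3.3".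

PROOF-ONLY file (cell abc-iut, row «TORSIONFREE-SUCCESSOR», abc-iut-L4-lead m151 (6); seat
abc-iut-L4-t4 gen 12; file 3 of the row).  abc-iut-L4-t6 proved (`SemiEllipticTransport.lean`) that
`φ` carries `semiEllipticDoubleCoverSubgroups Π₁` onto `semiEllipticDoubleCoverSubgroups Π₂` and
deduced the step-(ii) instance of the Cor 3.4 mechanism from the named fact `Cor_3_3_ii`.  Here the
same is PROVED for the print-faithful successors of finding T1g11-F1 (torsion-free = no nontrivial
element of finite order): `torsionFree_map_inf_geom` (an injective homomorphism REFLECTS "finite order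
⇒ trivial"; the `IsOfFinOrder` twin of `isMulTorsionFree_map_inf_geom` — abc-iut-L5-t1 proved the
analogous transport over `PuncturedEllipticData`, a different carrier),
`map_mem_semiEllipticDoubleCoverSubgroupsTF`, `image_semiEllipticDoubleCoverSubgroupsTF_eq`, and —
GIVEN the successor named facts — `Cor_3_3_iiTF.image_doubleCovers_eq`,
`EllipticModel.image_doubleCovers_eq_of_cor_3_3_iiTF`, `EllipticModel.map_PiD_mem_doubleCovers_of_cor_3_3_iiTF`.

HONEST FRAMING: elementary transport lemmas; the named facts stay hypotheses; nothing here bears on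
[IUTchIII] Cor 3.12 or asserts that abc is proved or refuted.  No `def`, no instance; axioms standard.
-/

noncomputable section

namespace Literature.AnabelianGeometry.AbsoluteAnabelian.AbsTopII

open FundamentalExtension

universe u

section TransportTF

variable {E F : FundamentalExtension.{u}}

/-- Membership in the image subgroup along `φ` is membership of `φ⁻¹ y`. [folklore] -/
private theorem mem_map_iff_symm_mem' (φ : E.arith ≃ₜ* F.arith) (J : Subgroup E.arith)
    (y : F.arith) : y ∈ J.map φ.toMulEquiv.toMonoidHom ↔ φ.symm y ∈ J := by
  constructor
  · rintro ⟨x, hx, rfl⟩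
    change φ.symm (φ x) ∈ J
    rwa [φ.symm_apply_apply]
  · intro h
    exact ⟨φ.symm y, h, φ.apply_symm_apply y⟩

/-- Mapping back and forth along `φ` is the identity on subgroups. [folklore] -/
private theorem map_symm_map' (φ : E.arith ≃ₜ* F.arith) (K : Subgroup F.arith) :
    (K.map φ.symm.toMulEquiv.toMonoidHom).map φ.toMulEquiv.toMonoidHom = K := by
  ext y
  rw [mem_map_iff_symm_mem']
  constructor
  · rintro ⟨z, hz, h⟩
    have : z = y := by
      have h' : φ (φ.symm z) = φ (φ.symm y) := congrArg φ h
      simpa only [φ.apply_symm_apply] using h'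
    rw [← this]; exact hz
  · intro hy
    exact ⟨y, hy, rfl⟩

/-- The inverse isomorphism also preserves `Δ`. [folklore] -/
private theorem geom_map_symm' (φ : E.arith ≃ₜ* F.arith)
    (hφ : E.geom.map φ.toMulEquiv.toMonoidHom = F.geom) :
    F.geom.map φ.symm.toMulEquiv.toMonoidHom = E.geom := by
  ext x
  rw [mem_map_iff_symm_mem', φ.symm_symm, ← hφ, mem_map_iff_symm_mem', φ.symm_apply_apply]

/-- **Print's torsion-freeness of `J ∩ Δ` is carried along `φ` with `φ(Δ₁) = Δ₂`** (the group
`φ(J) ∩ Δ₂` embeds into `J ∩ Δ₁` by `y ↦ φ⁻¹ y`, and an injective homomorphism reflects "finite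
order ⇒ trivial") — the `IsOfFinOrder` twin of abc-iut-L4-t6's `isMulTorsionFree_map_inf_geom`.
[cite: MochizukiAbsTopII2013, Cor 3.3 (ii) p.68] -/
theorem torsionFree_map_inf_geom (φ : E.arith ≃ₜ* F.arith)
    (hφ : E.geom.map φ.toMulEquiv.toMonoidHom = F.geom) {J : Subgroup E.arith}
    (hJ : ∀ g : ↥(J ⊓ E.geom), IsOfFinOrder g → g = 1) :
    ∀ g : ↥(J.map φ.toMulEquiv.toMonoidHom ⊓ F.geom), IsOfFinOrder g → g = 1 := by
  -- the injective homomorphism `φ(J) ∩ Δ₂ → J ∩ Δ₁`, `y ↦ φ⁻¹ y`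
  let f : ↥(J.map φ.toMulEquiv.toMonoidHom ⊓ F.geom) →* ↥(J ⊓ E.geom) :=
    { toFun := fun y => ⟨φ.symm y, (mem_map_inf_geom_iff φ hφ J y).mp y.2⟩
      map_one' := Subtype.ext (map_one φ.symm)
      map_mul' := fun a b => Subtype.ext (map_mul φ.symm (a : F.arith) (b : F.arith)) }
  have hf : Function.Injective f := by
    intro a b h
    have h' : φ.symm (a : F.arith) = φ.symm (b : F.arith) := congrArg Subtype.val h
    exact Subtype.ext (φ.symm.injective h')
  intro g hg
  have h1 : f g = 1 := hJ (f g) (f.isOfFinOrder hg)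
  exact hf (h1.trans (map_one f).symm)

/-- **The print-faithful description of Cor 3.3 (ii) is group-theoretic, hence `φ`-invariant**: an
open subgroup `J ⊆ Π₁` of index `2` with `J ∩ Δ₁` torsion-free is mapped by `φ : Π₁ ⥲ Π₂` (with
`φ(Δ₁) = Δ₂`) to such a subgroup of `Π₂`. [cite: MochizukiAbsTopII2013, Cor 3.3 (ii) p.68] -/
theorem map_mem_semiEllipticDoubleCoverSubgroupsTF (φ : E.arith ≃ₜ* F.arith)
    (hφ : E.geom.map φ.toMulEquiv.toMonoidHom = F.geom) {J : Subgroup E.arith}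
    (hJ : J ∈ semiEllipticDoubleCoverSubgroupsTF E) :
    J.map φ.toMulEquiv.toMonoidHom ∈ semiEllipticDoubleCoverSubgroupsTF F := by
  obtain ⟨hopen, hindex, htf⟩ := hJ
  refine ⟨?_, ?_, torsionFree_map_inf_geom φ hφ htf⟩
  · have : ((J.map φ.toMulEquiv.toMonoidHom : Subgroup F.arith) : Set F.arith) =
        φ '' (J : Set E.arith) := by
      ext y
      simp only [Subgroup.coe_map, Set.mem_image, SetLike.mem_coe]
      rfl
    rw [this]
    exact φ.toHomeomorph.isOpenMap _ hopen
  · rw [← hindex]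
    exact Subgroup.index_map_of_bijective
      (show Function.Bijective φ.toMulEquiv.toMonoidHom from φ.bijective) J

/-- **Set-level form**: `φ` induces a BIJECTION between the two print-faithful collections of
Cor 3.3 (ii). [cite: MochizukiAbsTopII2013, Cor 3.3 (ii) p.68] -/
theorem image_semiEllipticDoubleCoverSubgroupsTF_eq (φ : E.arith ≃ₜ* F.arith)
    (hφ : E.geom.map φ.toMulEquiv.toMonoidHom = F.geom) :
    (fun J : Subgroup E.arith => J.map φ.toMulEquiv.toMonoidHom) ''
        semiEllipticDoubleCoverSubgroupsTF E = semiEllipticDoubleCoverSubgroupsTF F := by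
  ext K
  constructor
  · rintro ⟨J, hJ, rfl⟩
    exact map_mem_semiEllipticDoubleCoverSubgroupsTF φ hφ hJ
  · intro hK
    refine ⟨K.map φ.symm.toMulEquiv.toMonoidHom,
      map_mem_semiEllipticDoubleCoverSubgroupsTF φ.symm (geom_map_symm' φ hφ) hK, ?_⟩
    exact map_symm_map' φ K

end TransportTF

/-- **Successor Cor 3.3 (ii) ⟹ its comparison version** (the step-(ii) instance of Cor 3.4's "The
construction of `φ_U` follows immediately from Corollary 3.3", proof p. 70), PROVED from the
successor named fact `Cor_3_3_iiTF`. [cite: MochizukiAbsTopII2013, Cor 3.4 p.70] -/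
theorem Cor_3_3_iiTF.image_doubleCovers_eq {M : IsogenyModel.{u}} (h : Cor_3_3_iiTF M)
    {C₁ C₂ : M.Curve} (hC₁ : M.IsSemiElliptic C₁) (hC₂ : M.IsSemiElliptic C₂)
    (φ : (M.ext C₁).arith ≃ₜ* (M.ext C₂).arith)
    (hφ : (M.ext C₁).geom.map φ.toMulEquiv.toMonoidHom = (M.ext C₂).geom) :
    (fun J : Subgroup (M.ext C₁).arith => J.map φ.toMulEquiv.toMonoidHom) ''
        M.ellipticDoubleCoverImages C₁ = M.ellipticDoubleCoverImages C₂ := by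
  rw [h C₁ hC₁, h C₂ hC₂]
  exact image_semiEllipticDoubleCoverSubgroupsTF_eq φ hφ

namespace EllipticModel

open AbsTopI (ConstructionDataClass)

variable {𝒟 : ConstructionDataClass.{u}} (M : EllipticModel 𝒟)

/-- **Successor Cor 3.3 (ii) ⟹ its comparison version, printed generality** (step (ii) of the
Cor 3.4 mechanism, PROVED from `EllipticModel.Cor_3_3_iiTF`).
[cite: MochizukiAbsTopII2013, Cor 3.4 p.70] -/
theorem image_doubleCovers_eq_of_cor_3_3_iiTF (h : M.Cor_3_3_iiTF) (hfull : 𝒟.IsChainFull)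
    (hGC : 𝒟.RelIsomDGC) {b₁ b₂ : 𝒟.Base} {X₁ : (𝒟.datum b₁).Obj} {X₂ : (𝒟.datum b₂).Obj}
    (hX₁ : M.IsCor33Member b₁ X₁) (hX₂ : M.IsCor33Member b₂ X₂)
    (φ : (M.coreExt b₁ X₁).arith ≃ₜ* (M.coreExt b₂ X₂).arith)
    (hφ : (M.coreExt b₁ X₁).geom.map φ.toMulEquiv.toMonoidHom = (M.coreExt b₂ X₂).geom) :
    (fun J : Subgroup (M.coreExt b₁ X₁).arith => J.map φ.toMulEquiv.toMonoidHom) ''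
        M.doubleCovers b₁ X₁ = M.doubleCovers b₂ X₂ := by
  rw [h hfull hGC b₁ X₁ hX₁, h hfull hGC b₂ X₂ hX₂]
  exact image_semiEllipticDoubleCoverSubgroupsTF_eq φ hφ

/-- In particular the setting subgroup `Π_{D₁}` of any setting of `X₁` is carried by `φ` to a member
of `doubleCovers` of `X₂` (given the successor `Cor_3_3_iiTF`).
[cite: MochizukiAbsTopII2013, Cor 3.4 p.70] -/
theorem map_PiD_mem_doubleCovers_of_cor_3_3_iiTF (h : M.Cor_3_3_iiTF) (hfull : 𝒟.IsChainFull)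
    (hGC : 𝒟.RelIsomDGC) {b₁ b₂ : 𝒟.Base} {X₁ : (𝒟.datum b₁).Obj} {X₂ : (𝒟.datum b₂).Obj}
    (hX₁ : M.IsCor33Member b₁ X₁) (hX₂ : M.IsCor33Member b₂ X₂)
    (φ : (M.coreExt b₁ X₁).arith ≃ₜ* (M.coreExt b₂ X₂).arith)
    (hφ : (M.coreExt b₁ X₁).geom.map φ.toMulEquiv.toMonoidHom = (M.coreExt b₂ X₂).geom)
    (s₁ : M.Setting b₁ X₁) :
    (M.PiD s₁).map φ.toMulEquiv.toMonoidHom ∈ M.doubleCovers b₂ X₂ := by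
  rw [← M.image_doubleCovers_eq_of_cor_3_3_iiTF h hfull hGC hX₁ hX₂ φ hφ]
  exact ⟨M.PiD s₁, M.PiD_mem s₁, rfl⟩

end EllipticModel

end Literature.AnabelianGeometry.AbsoluteAnabelian.AbsTopII

end
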